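import Literature.MathematicalPhysics.QuantumLattice.VariationalPressureBoxPartitionFunctionBound
import Literature.MathematicalPhysics.QuantumLattice.InfVolFermionStateBounds
import Literature.MathematicalPhysics.QuantumLattice.GibbsLogPartitionTemperatureCouplingConvexity
import HarnessLib

/-!
# WEIGHTED OPEN CLUSTERS bound every finite-range lattice-fermion model on `ℤ^d`:
# the mean energy from below (T = 0, Anderson–Valentí–Stolze–Hirschfeld) and the variational pressure from above (T > 0),
# with translation multipliers — for ARBITRARY translation-invariant interactions

Topic `Literature/MathematicalPhysics/QuantumLattice` (family `hubbard`; crew hubbard-fast S2 «families of models, T ≥ 0»).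
Let `Ψ` be a translation-covariant interaction of finite range `R` on `ℤ^d`, `B ⊆ ℤ^d` a finite WINDOW and
`w : {subsets of ℤ^d} → ℝ` a WEIGHT. Call `w` ADMISSIBLE for `(B, Ψ)` with MASS `M` when, for every interacting shape `X ∋ 0`
(`Ψ X ≠ 0`), the weights of the translates of `X` lying inside `B` add up to `M`:
`Σ_{y ∈ B : X + y ⊆ B} w(X + y) = M` (this is the hypothesis `hw` below; e.g. the UNIFORM weight `w(Y) = M/#{placements of Y in B}`,
or Valentí–Stolze–Hirschfeld's position-dependent bond weights). The REWEIGHTED interaction `Ψ^w X = w(X)·Ψ X` has the open-cluster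
Hamiltonian `H^w_B = Σ_{X ⊆ B} w(X) Ψ X`. Then:

* §1 **THE TRANSLATION-CLASS IDENTITY** `IsTranslationInvariant.sum_mul_expect_eq_of_admissible`: for every translation-invariant
  state `ω`, `Σ_{X ⊆ B} w(X) ω(Ψ X) = M · ω(E_Ψ) + w(∅) ω(Ψ ∅)` (`E_Ψ = Σ_{X ∋ 0} Ψ X/|X|` the mean-energy observable) — the
  energy of the weighted cluster in `ω` is EXACTLY `M` mean energies (re-root every region at each of its points, Fubini, translation
  invariance of `X ↦ ω(Ψ X)`, admissibility); `…re_expect_localHamiltonian_reweight` is the form `Re ω(H^w_B) = M e_Ψ(ω) + w(∅)(Ψ∅)_{∅∅}`.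
* §2 **T = 0 (the weighted Anderson bound for every model)** `IsTranslationInvariant.le_mul_meanEnergy_of_posSemidef_reweight`:
  an operator certificate `H^w_B + G − q·1 ⪰ 0` on the cluster Fock space, with ANY `G ∈ 𝔄_B` killed by translation-invariant
  states (`Re ω(G) = 0`, e.g. differences of translates of a local observable inside `B`), gives `q − w(∅)(Ψ∅) ≤ M · e_Ψ(ω)` for
  EVERY translation-invariant `ω`.
* §3 **T > 0 (the entropy-subadditivity cap for every model)** `varPressure_le_log_partitionFn_reweight`: for `B = [0,n)^d`, an
  admissible weight of mass `n^d`, Hermitian `Ψ`, every real `β` and every Hermitian multiplier `G` killed by translation-invariant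
  states: `n^d · P(β, Ψ) ≤ log Re Tr e^{−(β H^w_B − G)} + β w(∅) (Ψ∅)_{∅∅}` — Gibbs' inequality for the box marginal of `ω`,
  `s̄(ω) ≤ S(ω_{[0,n)^d})/n^d`, and the EXACT energy identity of §1 (no collar term; compare `VariationalPressureBoxPartitionFunctionBound`,
  whose unweighted box Hamiltonian pays `|β|·|collar|·S_Ψ`).
* §4 the admissible multipliers: `Re ω(Γ A − Γ τ_v A) = 0` and real combinations thereof (`IsTranslationInvariant.re_expect_sum_sub_shift`).

The `t–t'` Hubbard square-box instance with uniform weights (`κ = ℓ/(ℓ−1)` on bonds, `κ²` on diagonal bonds) is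
`HubbardTTPrimeOpenBoxGrandCanonicalPressureCap`; this file is the model-free law (decorated lattices, layered models, `t''`, several
hopping vectors, any on-site terms: whatever `FermionInteraction` encodes). Everything is PROVED; no definition (the reweighted interaction is
the structure literal `⟨fun X ↦ (w X : ℂ) • Ψ.Φ X⟩`), no named fact, no number.

## Mathlib / tree search

REUSED: `sum_sum_filter_mem_eq_sum_card_inter_smul` (Fubini with multiplicities), `HasFiniteRange.subset_thicken_singleton`,
`IsTranslationInvariant.expect_apply_shiftSet`, `expect_localHamiltonian_eq_sum`, `expect_empty_eq`
(`TranslationInvariantGroundStatesAreMeanEnergyMinimisers`); `KrausPattern.expect_meanEnergyObs`, `KrausPattern.shiftSet_shiftSet_neg /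
shiftSet_neg_shiftSet` (`SparseKrausPerturbedStateEnergy`); `mem_shiftSet`, `card_shiftSet`; `varPressure_le_of_boxEntropy`, `boxEntropyDensity_apply`
(`TIStateMeanEntropy`, `TIVariationalPressure`); `IsHermitian.vonNeumannEntropy_sub_mul_le_log_partitionFn` (`GibbsVariationalPrinciple`);
`trace_rdm_mul`, `rdm_posSemidef`, `trace_rdm`, `expect_re_nonneg_of_posSemidef` (`InfVolFermionStateBounds`).
`lean search 'reweight|admissible.*weight|weighted.*localHamiltonian.*varPressure'` (2026-08-28): nothing model-free; the NN-Hubbard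
weighted clusters are `HubbardAndersonClusterBound` (`andersonCluster`, torus route) and `Transport/TiltedAndersonCluster` (T = 0 only).

## References

* P. W. Anderson, Phys. Rev. 83 (1951) 1260, eq. (2). [cite: Anderson1951, eq. (2)]
* R. Valentí, J. Stolze, P. J. Hirschfeld, Phys. Rev. B 43 (1991) 13743, §II (weighted clusters). [cite: ValentiStolzeHirschfeld1991, §II]
* R. B. Israel, *Convexity in the Theory of Lattice Gases* (1979), Lemma II.3.1. [cite: Israel1979, Lemma II.3.1]
* H. Araki, H. Moriya, Rev. Math. Phys. 15 (2003) 93, Thm. 3.8 and §10. [cite: ArakiMoriya2003, Theorem 3.8 and §10]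
* O. Bratteli, D. W. Robinson, *OAQSM 2* (1997), §6.2.4. [cite: BratteliRobinsonII1997, §6.2.4 (Prop. 6.2.38 ff.)]
-/

noncomputable section

open scoped ComplexOrder BigOperators
open Finset Literature.InformationTheory.Entropy

namespace Literature.MathematicalPhysics.QuantumLattice

open Matrix HubbardWave0 Literature.Probability.LatticeModels ThermodynamicLimit
open scoped Matrix.Norms.L2Operator

namespace InfVolFermionState

variable {d : ℕ} {Ψ : FermionInteraction d} {R : ℝ} {ω : InfVolFermionState d}

/-! ### §1 The translation-class identity for admissible weights -/

/-- **Re-rooting one site's regions at the origin, with weights**: for every `y`, every finite `B` and every function `g`,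
`Σ_{X ⊆ B, y ∈ X} g X = Σ_{X' ⊆ B − y, 0 ∈ X'} g (X' + y)`. [cite: BratteliRobinsonII1997, §6.2.4 (Prop. 6.2.38 ff.)] -/
theorem sum_filter_mem_eq_sum_filter_zero_mem_shiftSet {N : Type*} [AddCommMonoid N] (B : Finset (Site d)) (y : Site d)
    (g : Finset (Site d) → N) :
    ∑ X ∈ B.powerset with y ∈ X, g X = ∑ X ∈ (shiftSet (-y) B).powerset with (0 : Site d) ∈ X, g (shiftSet y X) := by
  refine Finset.sum_nbij' (fun X => shiftSet (-y) X) (fun X => shiftSet y X) (fun X hX => ?_) (fun X hX => ?_)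
    (fun X _ => KrausPattern.shiftSet_shiftSet_neg y X) (fun X _ => KrausPattern.shiftSet_neg_shiftSet y X)
    (fun X _ => by rw [KrausPattern.shiftSet_shiftSet_neg])
  · rw [Finset.mem_filter, Finset.mem_powerset] at hX ⊢
    refine ⟨Finset.map_subset_map.2 hX.1, ?_⟩
    rw [mem_shiftSet, sub_neg_eq_add, zero_add]
    exact hX.2
  · rw [Finset.mem_filter, Finset.mem_powerset] at hX ⊢
    refine ⟨?_, ?_⟩
    · have h : shiftSet y X ⊆ shiftSet y (shiftSet (-y) B) := Finset.map_subset_map.2 hX.1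
      rwa [KrausPattern.shiftSet_shiftSet_neg] at h
    · rw [mem_shiftSet, sub_self]
      exact hX.2

/-- **THE TRANSLATION-CLASS IDENTITY.** Let `Ψ` be translation covariant of finite range `R`, `ω` translation invariant, `B` finite,
and `w` an ADMISSIBLE weight of mass `M`: for every interacting shape `X ∋ 0`, `Σ_{y ∈ B : X + y ⊆ B} w(X + y) = M`. Then
`Σ_{X ⊆ B} w(X)·ω(Ψ X) = M·ω(E_Ψ) + w(∅)·ω(Ψ ∅)` — the weighted cluster energy is exactly `M` mean energies.
[cite: ValentiStolzeHirschfeld1991, §II] [cite: BratteliRobinsonII1997, §6.2.4 (Prop. 6.2.38 ff.)] -/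
theorem IsTranslationInvariant.sum_mul_expect_eq_of_admissible (hω : ω.IsTranslationInvariant) (hT : Ψ.IsTranslationInvariant)
    (hR : Ψ.HasFiniteRange R) (B : Finset (Site d)) (w : Finset (Site d) → ℝ) (M : ℝ)
    (hw : ∀ X : Finset (Site d), (0 : Site d) ∈ X → Ψ.Φ X ≠ 0 → ∑ y ∈ B with shiftSet y X ⊆ B, w (shiftSet y X) = M) :
    ∑ X ∈ B.powerset, (w X : ℂ) * ω.expect X (Ψ.Φ X) =
      (M : ℂ) * ω.expect _ (Ψ.meanEnergyObs R) + (w ∅ : ℂ) * ω.expect ∅ (Ψ.Φ ∅) := by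
  classical
  set φ : Finset (Site d) → ℂ := fun X => ω.expect X (Ψ.Φ X) with hφ
  have hφT : ∀ (v : Site d) (X : Finset (Site d)), φ (shiftSet v X) = φ X := fun v X => hω.expect_apply_shiftSet hT v X
  have hφ0 : ∀ X, Ψ.Φ X = 0 → φ X = 0 := fun X h => by simp only [hφ, h, map_zero]
  -- split off the empty region and insert `|X|·|X|⁻¹`
  have hsplit : ∑ X ∈ B.powerset, (w X : ℂ) * φ X =
      ∑ X ∈ B.powerset, (X.card : ℂ) * ((X.card : ℂ)⁻¹ * ((w X : ℂ) * φ X)) + (w ∅ : ℂ) * φ ∅ := by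
    rw [← Finset.sum_erase_add _ _ (Finset.empty_mem_powerset B)]
    have h2 : ∑ X ∈ B.powerset, (X.card : ℂ) * ((X.card : ℂ)⁻¹ * ((w X : ℂ) * φ X)) =
        ∑ X ∈ (B.powerset).erase ∅, (X.card : ℂ) * ((X.card : ℂ)⁻¹ * ((w X : ℂ) * φ X)) := by
      rw [← Finset.sum_erase_add _ _ (Finset.empty_mem_powerset B), Finset.card_empty, Nat.cast_zero, zero_mul, add_zero]
    rw [h2]
    congr 1
    refine Finset.sum_congr rfl fun X hX => ?_
    have hne : X ≠ ∅ := (Finset.mem_erase.1 hX).1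
    have hc : (X.card : ℂ) ≠ 0 := Nat.cast_ne_zero.2 (Finset.card_ne_zero.2 (Finset.nonempty_iff_ne_empty.2 hne))
    rw [mul_inv_cancel_left₀ hc]
  rw [hsplit]
  congr 1
  -- Fubini: `Σ_X |X| g X = Σ_{y ∈ B} Σ_{X ∋ y} g X`
  have hfub := sum_sum_filter_mem_eq_sum_card_inter_smul B B.powerset (fun X => (X.card : ℂ)⁻¹ * ((w X : ℂ) * φ X))
  have hfub' : ∑ X ∈ B.powerset, (X.card : ℂ) * ((X.card : ℂ)⁻¹ * ((w X : ℂ) * φ X)) =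
      ∑ y ∈ B, ∑ X ∈ B.powerset with y ∈ X, (X.card : ℂ)⁻¹ * ((w X : ℂ) * φ X) := by
    rw [hfub]
    refine Finset.sum_congr rfl fun X hX => ?_
    rw [Finset.mem_powerset] at hX
    rw [Finset.inter_eq_left.2 hX, nsmul_eq_mul]
  rw [hfub']
  -- re-root at the origin and use translation invariance
  set T : Finset (Finset (Site d)) := ((thicken ({0} : Finset (Site d)) R).powerset).filter fun X => (0 : Site d) ∈ X with hTdef
  have hy : ∀ y ∈ B, ∑ X ∈ B.powerset with y ∈ X, (X.card : ℂ)⁻¹ * ((w X : ℂ) * φ X) =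
      ∑ X ∈ T, if shiftSet y X ⊆ B then (X.card : ℂ)⁻¹ * ((w (shiftSet y X) : ℂ) * φ X) else 0 := by
    intro y _
    rw [sum_filter_mem_eq_sum_filter_zero_mem_shiftSet B y]
    simp_rw [card_shiftSet, hφT]
    rw [← Finset.sum_filter]
    -- both sides are the sum over `V = {X : 0 ∈ X, X + y ⊆ B, X ⊆ thicken {0} R}` (terms outside `thicken` vanish)
    have hV : T.filter (fun X => shiftSet y X ⊆ B) =
        (((shiftSet (-y) B).powerset).filter fun X => (0 : Site d) ∈ X).filter
          fun X => X ⊆ thicken ({0} : Finset (Site d)) R := by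
      ext X
      simp only [hTdef, Finset.mem_filter, Finset.mem_powerset]
      constructor
      · rintro ⟨⟨h1, h2⟩, h3⟩
        refine ⟨⟨?_, h2⟩, h1⟩
        intro x hx
        rw [mem_shiftSet, sub_neg_eq_add]
        exact h3 (by rw [mem_shiftSet, add_sub_cancel_right]; exact hx)
      · rintro ⟨⟨h1, h2⟩, h3⟩
        refine ⟨⟨h3, h2⟩, ?_⟩
        intro x hx
        rw [mem_shiftSet] at hx
        have h := h1 hx
        rw [mem_shiftSet, sub_neg_eq_add, sub_add_cancel] at h
        exact h
    rw [hV]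
    refine (Finset.sum_filter_of_ne fun X hX hne => ?_).symm
    rw [Finset.mem_filter, Finset.mem_powerset] at hX
    by_contra hXt
    apply hne
    have h0 : Ψ.Φ X = 0 := by
      by_contra hΦ
      exact hXt (hR.subset_thicken_singleton hΦ hX.2)
    rw [hφ0 X h0, mul_zero, mul_zero]
  rw [Finset.sum_congr rfl hy, Finset.sum_comm]
  -- for each rooted shape, admissibility
  rw [KrausPattern.expect_meanEnergyObs, Finset.mul_sum]
  refine Finset.sum_congr rfl fun X hX => ?_
  simp only [Finset.mem_filter, Finset.mem_powerset] at hX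
  rw [← Finset.sum_filter]
  by_cases hΦ : Ψ.Φ X = 0
  · have h0 : ω.expect X (Ψ.Φ X) = 0 := hφ0 X hΦ
    simp only [hφ0 X hΦ, h0, mul_zero, Finset.sum_const_zero]
  · have h := hw X hX.2 hΦ
    have h' : ∑ y ∈ B with shiftSet y X ⊆ B, ((w (shiftSet y X) : ℝ) : ℂ) = (M : ℂ) := by
      rw [← Complex.ofReal_sum, h]
    calc ∑ y ∈ B with shiftSet y X ⊆ B, (X.card : ℂ)⁻¹ * ((w (shiftSet y X) : ℂ) * φ X)
        = (X.card : ℂ)⁻¹ * ((∑ y ∈ B with shiftSet y X ⊆ B, (w (shiftSet y X) : ℂ)) * φ X) := by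
          rw [Finset.sum_mul, Finset.mul_sum]
      _ = (M : ℂ) * ((X.card : ℂ)⁻¹ * φ X) := by rw [h']; ring

/-- **The reweighted open-cluster Hamiltonian in a translation-invariant state**: with `Ψ^w X = w(X) Ψ X`,
`Re ω(H^{Ψ^w}_B) = M · e_Ψ(ω) + w(∅)·(Ψ∅)_{∅∅}` for every admissible weight of mass `M` — NO boundary term.
[cite: ValentiStolzeHirschfeld1991, §II] [cite: BratteliRobinsonII1997, §6.2.4 (Prop. 6.2.38 ff.)] -/
theorem IsTranslationInvariant.re_expect_localHamiltonian_reweight (hω : ω.IsTranslationInvariant) (hT : Ψ.IsTranslationInvariant)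
    (hR : Ψ.HasFiniteRange R) (B : Finset (Site d)) (w : Finset (Site d) → ℝ) (M : ℝ)
    (hw : ∀ X : Finset (Site d), (0 : Site d) ∈ X → Ψ.Φ X ≠ 0 → ∑ y ∈ B with shiftSet y X ⊆ B, w (shiftSet y X) = M) :
    (ω.expect B ((⟨fun X => (w X : ℂ) • Ψ.Φ X⟩ : FermionInteraction d).localHamiltonian B)).re =
      M * ω.meanEnergy Ψ R + w ∅ * ((Ψ.Φ ∅) ∅ ∅).re := by
  rw [expect_localHamiltonian_eq_sum]
  have h : ∑ X ∈ B.powerset, ω.expect X (((⟨fun X => (w X : ℂ) • Ψ.Φ X⟩ : FermionInteraction d)).Φ X) =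
      ∑ X ∈ B.powerset, (w X : ℂ) * ω.expect X (Ψ.Φ X) :=
    Finset.sum_congr rfl fun X _ => by rw [map_smul, smul_eq_mul]
  rw [h, hω.sum_mul_expect_eq_of_admissible hT hR B w M hw, meanEnergy, expect_empty_eq, Complex.add_re, Complex.re_ofReal_mul,
    Complex.re_ofReal_mul]

/-! ### §2 T = 0: the weighted Anderson bound for every model, with translation multipliers -/

/-- **THE WEIGHTED ANDERSON BOUND (every finite-range model, every admissible weight, with multipliers).** If
`H^{Ψ^w}_B + G − q·1 ⪰ 0` on the cluster Fock space, where `G ∈ 𝔄_B` has `Re ω'(G) = 0` for every translation-invariant `ω'`,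
then `q − w(∅)(Ψ∅)_{∅∅} ≤ M · e_Ψ(ω)` for EVERY translation-invariant state `ω` (so `(q − w(∅)(Ψ∅))/M` is a floor on the
ground-state energy density and on the mean energy of every translation-invariant state: density-resolved floors follow by adding
`μ·n` terms to `Ψ`). [cite: Anderson1951, eq. (2)] [cite: ValentiStolzeHirschfeld1991, §II] -/
theorem IsTranslationInvariant.le_mul_meanEnergy_of_posSemidef_reweight (hω : ω.IsTranslationInvariant)
    (hT : Ψ.IsTranslationInvariant) (hR : Ψ.HasFiniteRange R) (B : Finset (Site d)) (w : Finset (Site d) → ℝ) (M : ℝ)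
    (hw : ∀ X : Finset (Site d), (0 : Site d) ∈ X → Ψ.Φ X ≠ 0 → ∑ y ∈ B with shiftSet y X ⊆ B, w (shiftSet y X) = M)
    {G : FermionOp B} (hG0 : ∀ ω' : InfVolFermionState d, ω'.IsTranslationInvariant → (ω'.expect B G).re = 0) {q : ℝ}
    (hq : ((⟨fun X => (w X : ℂ) • Ψ.Φ X⟩ : FermionInteraction d).localHamiltonian B + G - (q : ℂ) • (1 : FermionOp B)).PosSemidef) :
    q - w ∅ * ((Ψ.Φ ∅) ∅ ∅).re ≤ M * ω.meanEnergy Ψ R := by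
  have h0 := ω.expect_re_nonneg_of_posSemidef B hq
  rw [map_sub, map_add, map_smul, ω.expect_one, Complex.sub_re, Complex.add_re, smul_eq_mul, mul_one, Complex.ofReal_re,
    hω.re_expect_localHamiltonian_reweight hT hR B w M hw, hG0 ω hω] at h0
  linarith

/-! ### §3 T > 0: the entropy-subadditivity cap on the variational pressure for every model, with multipliers -/

/-- The reweighted interaction is Hermitian (real weights). [cite: ArakiMoriya2003, §1 assumption (II) (Φ(I)* = Φ(I))] -/
theorem _root_.Literature.MathematicalPhysics.QuantumLattice.FermionInteraction.IsHermitian.reweight (hH : Ψ.IsHermitian)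
    (w : Finset (Site d) → ℝ) : (⟨fun X => (w X : ℂ) • Ψ.Φ X⟩ : FermionInteraction d).IsHermitian := by
  intro X
  show ((w X : ℂ) • Ψ.Φ X).IsHermitian
  rw [Matrix.IsHermitian, Matrix.conjTranspose_smul, (hH X).eq, Complex.star_def, Complex.conj_ofReal]

/-- A real multiple of a Hermitian matrix minus a Hermitian matrix is Hermitian. [folklore] -/
private theorem isHermitian_ofReal_smul_sub' {m : Type*} {K G : Matrix m m ℂ} (hK : K.IsHermitian) (hG : G.IsHermitian)
    (c : ℝ) : ((c : ℂ) • K - G).IsHermitian := by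
  have h1 : ((c : ℂ) • K).IsHermitian := by
    rw [Matrix.IsHermitian, Matrix.conjTranspose_smul, hK.eq, Complex.star_def, Complex.conj_ofReal]
  exact h1.sub hG

/-- **Per-state form of the cap**: for `Ψ` Hermitian, translation covariant, of finite range `R`, an admissible weight `w` of
mass `n^d` for the box `[0,n)^d` (`n ≥ 1`, `d ≥ 1`), a Hermitian multiplier `G` killed by translation-invariant states, and every
real `β`: `S(ω_{[0,n)^d}) − β n^d e_Ψ(ω) ≤ log Re Tr e^{−(βH^{Ψ^w}_{[0,n)^d} − G)} + β w(∅)(Ψ∅)_{∅∅}` for every translation-invariant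
`ω` (Gibbs' inequality for the box marginal; the energy is EXACT by §1). [cite: Israel1979, Lemma II.3.1] -/
theorem IsTranslationInvariant.vonNeumannEntropy_sub_mul_le_log_partitionFn_reweight (hH : Ψ.IsHermitian)
    (hT : Ψ.IsTranslationInvariant) (hR : Ψ.HasFiniteRange R) (β : ℝ) {n : ℕ} (w : Finset (Site d) → ℝ)
    (hw : ∀ X : Finset (Site d), (0 : Site d) ∈ X → Ψ.Φ X ≠ 0 →
      ∑ y ∈ halfOpenBox d n with shiftSet y X ⊆ halfOpenBox d n, w (shiftSet y X) = (n : ℝ) ^ d)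
    {G : FermionOp (halfOpenBox d n)} (hGh : G.IsHermitian)
    (hG0 : ∀ ω' : InfVolFermionState d, ω'.IsTranslationInvariant → (ω'.expect (halfOpenBox d n) G).re = 0)
    (hω : ω.IsTranslationInvariant) :
    vonNeumannEntropy (ω.rdm (halfOpenBox d n)) - β * ((n : ℝ) ^ d * ω.meanEnergy Ψ R) ≤
      Real.log (partitionFn 1 ((β : ℂ) • (⟨fun X => (w X : ℂ) • Ψ.Φ X⟩ : FermionInteraction d).localHamiltonian (halfOpenBox d n) -
        G)).re + β * (w ∅ * ((Ψ.Φ ∅) ∅ ∅).re) := by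
  have hKh := FermionInteraction.localHamiltonian_isHermitian (hH.reweight w) (halfOpenBox d n)
  have hG := (isHermitian_ofReal_smul_sub' hKh hGh β).vonNeumannEntropy_sub_mul_le_log_partitionFn 1 (ω.rdm_posSemidef _)
    (ω.trace_rdm _)
  rw [Matrix.mul_sub, Matrix.mul_smul, Matrix.trace_sub, Matrix.trace_smul, smul_eq_mul, trace_rdm_mul, trace_rdm_mul,
    Complex.sub_re, Complex.re_ofReal_mul, hG0 ω hω, sub_zero,
    hω.re_expect_localHamiltonian_reweight hT hR (halfOpenBox d n) w ((n : ℝ) ^ d) hw, one_mul] at hG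
  linarith

/-- **THE T > 0 WEIGHTED-CLUSTER CAP FOR EVERY MODEL.** For `Ψ` Hermitian, translation covariant, of finite range `R` on `ℤ^d`
(`d ≥ 1`), the box `[0,n)^d` (`n ≥ 1`), an admissible weight `w` of mass `n^d`, a Hermitian multiplier `G ∈ 𝔄_{[0,n)^d}` killed by every
translation-invariant state, and every real `β`:
`n^d · P(β, Ψ) ≤ log Re Tr exp(−(β H^{Ψ^w}_{[0,n)^d} − G)) + β·w(∅)·(Ψ∅)_{∅∅}`.
ONE reweighted open cluster caps the thermodynamic-limit variational pressure of the model, with no boundary correction; `w` and `G` are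
free parameters of the certificate. [cite: Israel1979, Lemma II.3.1] [cite: ArakiMoriya2003, Theorem 3.8 and §10]
[cite: ValentiStolzeHirschfeld1991, §II] -/
theorem varPressure_le_log_partitionFn_reweight (hd : 0 < d) (hH : Ψ.IsHermitian) (hT : Ψ.IsTranslationInvariant)
    (hR : Ψ.HasFiniteRange R) (β : ℝ) {n : ℕ} (hn : 1 ≤ n) (w : Finset (Site d) → ℝ)
    (hw : ∀ X : Finset (Site d), (0 : Site d) ∈ X → Ψ.Φ X ≠ 0 →
      ∑ y ∈ halfOpenBox d n with shiftSet y X ⊆ halfOpenBox d n, w (shiftSet y X) = (n : ℝ) ^ d)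
    {G : FermionOp (halfOpenBox d n)} (hGh : G.IsHermitian)
    (hG0 : ∀ ω' : InfVolFermionState d, ω'.IsTranslationInvariant → (ω'.expect (halfOpenBox d n) G).re = 0) :
    (n : ℝ) ^ d * Ψ.varPressure β R ≤
      Real.log (partitionFn 1 ((β : ℂ) • (⟨fun X => (w X : ℂ) • Ψ.Φ X⟩ : FermionInteraction d).localHamiltonian (halfOpenBox d n) -
        G)).re + β * (w ∅ * ((Ψ.Φ ∅) ∅ ∅).re) := by
  have hnd : (0 : ℝ) < (n : ℝ) ^ d := by positivity
  rw [← le_div_iff₀' hnd]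
  refine varPressure_le_of_boxEntropy hd β Ψ R hn fun ω hω => ?_
  rw [le_div_iff₀' hnd, boxEntropyDensity_apply, mul_sub, mul_div_cancel₀ _ hnd.ne']
  have h := hω.vonNeumannEntropy_sub_mul_le_log_partitionFn_reweight hH hT hR β w hw hGh hG0
  linarith

/-- **Without multipliers** (`G = 0`): `n^d · P(β, Ψ) ≤ log Re Tr e^{−βH^{Ψ^w}_{[0,n)^d}} + β w(∅)(Ψ∅)_{∅∅}`.
[cite: Israel1979, Lemma II.3.1] [cite: ArakiMoriya2003, Theorem 3.8 and §10] -/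
theorem varPressure_le_log_partitionFn_reweight' (hd : 0 < d) (hH : Ψ.IsHermitian) (hT : Ψ.IsTranslationInvariant)
    (hR : Ψ.HasFiniteRange R) (β : ℝ) {n : ℕ} (hn : 1 ≤ n) (w : Finset (Site d) → ℝ)
    (hw : ∀ X : Finset (Site d), (0 : Site d) ∈ X → Ψ.Φ X ≠ 0 →
      ∑ y ∈ halfOpenBox d n with shiftSet y X ⊆ halfOpenBox d n, w (shiftSet y X) = (n : ℝ) ^ d) :
    (n : ℝ) ^ d * Ψ.varPressure β R ≤
      Real.log (partitionFn β ((⟨fun X => (w X : ℂ) • Ψ.Φ X⟩ : FermionInteraction d).localHamiltonian (halfOpenBox d n))).re +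
        β * (w ∅ * ((Ψ.Φ ∅) ∅ ∅).re) := by
  have h := varPressure_le_log_partitionFn_reweight hd hH hT hR β hn w hw (Matrix.isHermitian_zero)
    (fun ω' _ => by rw [map_zero, Complex.zero_re])
  rwa [sub_zero, partitionFn_one_real_smul] at h

/-! ### §4 Admissible multipliers: translation differences -/

/-- **Translation differences are killed**: `Re ω(Γ A − Γ τ_v A) = 0` for `A ∈ 𝔄_X`, `X, X + v ⊆ Λ`, and every translation-invariant
`ω`. [cite: BratteliRobinsonI1987, §4.3.1] -/
theorem IsTranslationInvariant.re_expect_fermionEmbed_sub_shift (hω : ω.IsTranslationInvariant) {X Λ : Finset (Site d)}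
    (hX : X ⊆ Λ) (v : Site d) (hv : shiftSet v X ⊆ Λ) (A : FermionOp X) :
    (ω.expect Λ (fermionEmbed (PolySite.incl hX) A - fermionEmbed (PolySite.incl hv) (fermionEmbed (PolySite.shiftEmb v X) A))).re = 0 := by
  rw [map_sub, ω.compatible hX, ω.compatible hv, ← shift_expect, hω v, sub_self, Complex.zero_re]

/-- **Real combinations of translation differences are killed**: for families `X_j ⊆ Λ`, `v_j` with `X_j + v_j ⊆ Λ`, `A_j ∈ 𝔄_{X_j}` and
real `c_j`, `G = Σ_j c_j (Γ A_j − Γ τ_{v_j} A_j)` has `Re ω(G) = 0` for every translation-invariant `ω` — the admissible multipliers of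
§2–§3 (Hermitian when the `A_j` are). [cite: BratteliRobinsonI1987, §4.3.1] -/
theorem IsTranslationInvariant.re_expect_sum_sub_shift (hω : ω.IsTranslationInvariant) {Λ : Finset (Site d)} {ι : Type*}
    (s : Finset ι) (X : ι → Finset (Site d)) (hX : ∀ j, X j ⊆ Λ) (v : ι → Site d) (hv : ∀ j, shiftSet (v j) (X j) ⊆ Λ)
    (A : ∀ j, FermionOp (X j)) (c : ι → ℝ) :
    (ω.expect Λ (∑ j ∈ s, (c j : ℂ) • (fermionEmbed (PolySite.incl (hX j)) (A j) -
      fermionEmbed (PolySite.incl (hv j)) (fermionEmbed (PolySite.shiftEmb (v j) (X j)) (A j))))).re = 0 := by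
  rw [map_sum, Complex.re_sum]
  refine Finset.sum_eq_zero fun j _ => ?_
  rw [map_smul, smul_eq_mul, Complex.re_ofReal_mul, hω.re_expect_fermionEmbed_sub_shift (hX j) (v j) (hv j) (A j), mul_zero]

/-- Such a combination is Hermitian when every `A_j` is. [cite: BratteliRobinsonI1987, §4.3.1] -/
theorem isHermitian_sum_sub_shift {Λ : Finset (Site d)} {ι : Type*} (s : Finset ι) (X : ι → Finset (Site d)) (hX : ∀ j, X j ⊆ Λ)
    (v : ι → Site d) (hv : ∀ j, shiftSet (v j) (X j) ⊆ Λ) {A : ∀ j, FermionOp (X j)} (hA : ∀ j ∈ s, (A j).IsHermitian)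
    (c : ι → ℝ) :
    (∑ j ∈ s, (c j : ℂ) • (fermionEmbed (PolySite.incl (hX j)) (A j) -
      fermionEmbed (PolySite.incl (hv j)) (fermionEmbed (PolySite.shiftEmb (v j) (X j)) (A j)))).IsHermitian := by
  have hterm : ∀ j ∈ s, ((c j : ℂ) • (fermionEmbed (PolySite.incl (hX j)) (A j) -
      fermionEmbed (PolySite.incl (hv j)) (fermionEmbed (PolySite.shiftEmb (v j) (X j)) (A j)))).IsHermitian := by
    intro j hj
    have h1 : (fermionEmbed (PolySite.incl (hX j)) (A j) -
      fermionEmbed (PolySite.incl (hv j)) (fermionEmbed (PolySite.shiftEmb (v j) (X j)) (A j))).IsHermitian := by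
      refine Matrix.IsHermitian.sub ?_ ?_
      · rw [Matrix.IsHermitian, ← fermionEmbed_conjTranspose, (hA j hj).eq]
      · rw [Matrix.IsHermitian, ← fermionEmbed_conjTranspose, ← fermionEmbed_conjTranspose, (hA j hj).eq]
    rw [Matrix.IsHermitian, Matrix.conjTranspose_smul, h1.eq, Complex.star_def, Complex.conj_ofReal]
  unfold Matrix.IsHermitian
  rw [Matrix.conjTranspose_sum]
  exact Finset.sum_congr rfl fun j hj => (hterm j hj).eq

end InfVolFermionState

end Literature.MathematicalPhysics.QuantumLattice

end
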